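import Summits.QuantumFields.YangMills.Theorems.UnitScaleTiltProp7OneFormGreenSupRowsOfBlockRows
import Summits.QuantumFields.YangMills.Theorems.UnitScaleTiltProp7OneFormGreenBlockDivergenceFamily
import Summits.QuantumFields.YangMills.Theorems.UnitScaleTiltProp7OneFormGreenBlockSupFamily
import HarnessLib

/-!
# Route `UnitScaleTilt`, crux K1 «MinimiserStabilityRegPr» (stmt-QuantumFields-19200), EX face, norm_G ∕ h133 road — **(V0)+(D0), FAMILY EDITIONS: THE SUP VALUE ROW AND THE SUP
# COVARIANT-DIVERGENCE ROW OF `G₀` ON SUP-BOUNDED SOURCES FOR ALL MEMBERS, L-ONLY CONSTANTS** — FILE C ∕ (O-G1)'s `hV` ∕ `hDiv` letters as `∃`-packages over px16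
# ✓`blockSup_GT_DeltaEtaSlot_family` ((Gb)-FAMILY) and px21 ✓`divergence_GT_DeltaEtaSlot_family` ((Db)-FAMILY) by ✓`Prop7OneFormGreenSupRowsOfBlockRows.sup_of_blockSupported`
# (✓`weighted_of_blockSupported` at weight rate `0`) per member; then the JOINT package at one cap.  (width seat `ym3-torus-px21` g16.)

Cell `ym3-torus` (HUMAN RULING D-0037; rung R3 = SU(2) YM₃ on T³ — NOT d = 4, NOT infinite volume, NOT a mass gap, NOT Clay).  THEOREMS ONLY (0 `def`, 0 `sorry`, default
heartbeats); `--supports stmt-QuantumFields-19200 --as helper`; count-neutral.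

WHAT IS PROVED (ns `Summit.QuantumFields.YangMills.Theorems.Prop7OneFormGreenSupRowsFamily`).  For positive L-only weights `c₀ cB : ℕ → ℝ` and a coupling window `0 < a₀ ≤ a₁`:
* ★★★ `value_GT_DeltaEtaSlot_sup_family` — **(V0) FOR ALL MEMBERS**: `∃ αG BV : ℕ → ℝ` (cap with the three windows of record, `0 ≤ BV L`) such that for every `L > 1`, member `i : Idx L`,
  background `U₀` with `RegPr ρ U₀`, `ρ ≤ αG L`, under `Lift`, every coupling in the window: the `hV` TEXT `∀ X s, (∀ b, ‖X b‖ ≤ s) → ∀ bd, ‖toL2⁻¹(G₀(toL2 X)) bd‖ ≤ BV L * s`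
  (binder texts = (Gb)-FAMILY's; `BV L := BV_blk L·(2(1+1∕δG L))³`).
* ★★★ `divergence_GT_DeltaEtaSlot_sup_family` — **(D0) FOR ALL MEMBERS WITH ROOM**: `∃ αG BD : ℕ → ℝ` (same windows, `0 ≤ BD L`) such that, additionally GIVEN THE MEMBER'S NO-WRAP ROOM
  `2(12ℓ + 5) ≤ sitesPerDir 0` (displayed — the T1-lineage letter; small members want the cover road, CHAIR WORD №1 class): the `hDiv` TEXT
  `∀ X s, (∀ b, ‖X b‖ ≤ s) → ∀ x, ‖toL2S⁻¹(D*_{U₀}(G₀(toL2 X))) x‖ ≤ BD L * s` (binder texts = (Db)-FAMILY's).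
* ★★★ `valueDiv_GT_DeltaEtaSlot_sup_family` — **THE JOINT PACKAGE AT ONE CAP**: `∃ αG BV BD : ℕ → ℝ` (windows, `0 ≤ BV L`, `0 ≤ BD L`) with, per member under `Lift` in the window and
  given the ROOM, BOTH texts (cap `:= min` of the two) — FILE C ∕ (O-G1)'s `hBV hBD hV hDiv` slots for every member at once.
HYP-SAT (★★OWNER RULING №42).  Nothing displayed beyond `RegPr`∕cap∕`Lift`∕coupling window∕ROOM (all classes of record); constants EXISTENTIAL-but-L-only ([Balaban1985Variational] Thm 1:
«constants depend on `L` only»); conclusions non-vacuous; no `Prop` placeholder.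
HONEST SCOPE.  `∃`-bookkeeping over landed families; no kernel estimate is proved here; nothing of FILE C, (O-G1), `norm_G`, `h133`, the 8 EX rows, `hThm2S`, EX, 19200 or the rung is
proved; no summit is proved by a helper; the Yang–Mills mass gap is NOT proved.

References: T. Bałaban, CMP **99** (1985) 389–434 [Balaban1985BackgroundPropagators] (Thm 3.1 (3.42)–(3.44) p.397, Thm 3.3 (3.47)–(3.49) pp.398–399, Thm 3.12 p.422–423);
CMP **102** (1985) 277–309 [Balaban1985Variational] (Thm 1 p.279 (L-only constants), (134)–(135) p.298).
-/

set_option autoImplicit false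

noncomputable section

open scoped Matrix.Norms.L2Operator BigOperators InnerProductSpace ComplexConjugate

namespace Summit.QuantumFields.YangMills.Theorems.Prop7OneFormGreenSupRowsFamily

open Literature.MathematicalPhysics.QuantumFieldTheory.Balaban1983to89
open Literature.MathematicalPhysics.QuantumFieldTheory.Balaban1983to89.T3ContinuumYM3Torus
open Literature.MathematicalPhysics.QuantumFieldTheory.Balaban1983to89.T3PrintedRegularMinimiser (RegPr)
open B15DeterminingSets (embIter)
open T3SectALandauChart (formComp bgUnits eta eta_pos)
open B9SectCLatticeCarrier (Bond)
open B9Eq311L2Pairing (WL2)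
open B11Eq103H1Complex (BondL2K SiteL2K)
open B5Eq118OneStroke (iterBlockOf)
open Summit.QuantumFields.YangMills.Theorems.Prop8Chart (emlIterU)
open Summit.QuantumFields.YangMills.Theorems.Prop7SectET3Transport (periodsT3 bondEquiv)
open Summit.QuantumFields.YangMills.Theorems.Prop7SectET3HilbertLetters (W₂ toL2 toL2S DL2 DstarL2)
open Summit.QuantumFields.YangMills.Theorems.Prop7SectET3WilsonHessian (DeltaEtaSlot)
open Summit.QuantumFields.YangMills.Theorems.Prop7SectET3GaugeProjector (RS)
open Summit.QuantumFields.YangMills.Theorems.Prop7SectET3CurvedPropagators (laplaceA Qk GT PosOnto)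
open Summit.QuantumFields.YangMills.Theorems.Prop7OneFormGreenSupRowsOfBlockRows (sup_of_blockSupported valueReader_blockAdditive divReader_blockAdditive)
open Summit.QuantumFields.YangMills.Theorems.Prop7OneFormGreenBlockDivergenceFamily (divergence_GT_DeltaEtaSlot_family)
open Summit.QuantumFields.YangMills.Theorems.Prop7OneFormGreenBlockSupFamily (blockSup_GT_DeltaEtaSlot_family)

/-! ## §1 (V0) and (D0) for all members, L-only constants -/


/-- ★★★ **(V0) FOR ALL MEMBERS, L-ONLY CONSTANTS** — FILE C ∕ (O-G1)'s `hV` letter (the sup value row of `G₀` on sup-bounded sources) for every `L > 1`, every member `i : Idx L`, every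
printed-regular background below the cap, under `Lift`, in the coupling window: `∃ αG BV : ℕ → ℝ` with the three windows of record and `0 ≤ BV L`; binder texts = px16
✓`blockSup_GT_DeltaEtaSlot_family`'s, conclusion the SUP text (`BV L := BV_blk L·(2(1+1∕δG L))³`).  PROOF: that family's package and §1 per member.
[cite: Balaban1985BackgroundPropagators, Thm 3.3 (3.47)–(3.49) pp.398–399, Thm 3.1 (3.42) p.397, Thm 3.12 p.423; Balaban1985Variational, Thm 1 p.279] -/
theorem value_GT_DeltaEtaSlot_sup_family (c₀ cB : ℕ → ℝ) [hc₀ : ∀ L : ℕ, Fact (0 < c₀ L)] [hcB : ∀ L : ℕ, Fact (0 < cB L)] {a₀ a₁ : ℝ} (ha₀ : 0 < a₀) (ha₀₁ : a₀ ≤ a₁) :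
    ∃ (αG BV : ℕ → ℝ),
      (∀ L : ℕ, 1 < L → 0 < αG L) ∧ (∀ L : ℕ, 1 < L → 10 ^ 12 * (L : ℝ) ^ 3 * αG L ≤ 1) ∧ (∀ L : ℕ, 1 < L → 10 ^ 10 * (L : ℝ) ^ 6 * αG L ≤ 1) ∧
      (∀ L : ℕ, 1 < L → 13 * 10 ^ 14 * (L : ℝ) ^ 3 * αG L ≤ 1) ∧ (∀ L : ℕ, 1 < L → 0 ≤ BV L) ∧
    ∀ (L : ℕ), 1 < L → ∀ (i : T3Thm1Carrier.Idx L) (U₀ : GaugeField (i.1.1.P i.1.2.2) 0 (Matrix.specialUnitaryGroup (Fin 2) ℂ)), ∀ ρ : ℝ, RegPr i.1.1 i.1.2.1 i.1.2.2 ρ U₀ → ρ ≤ αG L →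
        (∀ cf : Site (i.1.1.P i.1.2.2) (i.1.2.2 - i.1.2.1) → Matrix (Fin 2) (Fin 2) ℂ,
        (∀ e' : PBond (i.1.1.P i.1.2.2) (i.1.2.2 - i.1.2.1), cf e'.src = ((emlIterU (i.1.2.2 - i.1.2.1) (bgUnits i.1.1 i.1.2.2 U₀) e' : (Matrix (Fin 2) (Fin 2) ℂ)ˣ) : Matrix (Fin 2) (Fin 2) ℂ) * cf e'.tgt *
        (((emlIterU (i.1.2.2 - i.1.2.1) (bgUnits i.1.1 i.1.2.2 U₀) e')⁻¹ : (Matrix (Fin 2) (Fin 2) ℂ)ˣ) : Matrix (Fin 2) (Fin 2) ℂ)) →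
        ∃ l₀ : Site (i.1.1.P i.1.2.2) 0 → Matrix (Fin 2) (Fin 2) ℂ,
        (∀ b' : PBond (i.1.1.P i.1.2.2) 0, l₀ b'.src = ((bgUnits i.1.1 i.1.2.2 U₀ b' : (Matrix (Fin 2) (Fin 2) ℂ)ˣ) : Matrix (Fin 2) (Fin 2) ℂ) * l₀ b'.tgt * (((bgUnits i.1.1 i.1.2.2 U₀ b')⁻¹ : (Matrix (Fin 2) (Fin 2) ℂ)ˣ) : Matrix (Fin 2) (Fin 2) ℂ)) ∧
        ∀ y : Site (i.1.1.P i.1.2.2) (i.1.2.2 - i.1.2.1), l₀ (embIter (i.1.2.2 - i.1.2.1) y) = cf y) →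
      ∀ a : ℝ, a₀ * (c₀ L / cB L) * ((i.1.1.L : ℝ) ^ (i.1.2.2 - i.1.2.1)) ^ 3 ≤ a → a ≤ a₁ * (c₀ L / cB L) * ((i.1.1.L : ℝ) ^ (i.1.2.2 - i.1.2.1)) ^ 3 →
      ∀ (X : PBond (i.1.1.P i.1.2.2) 0 → Matrix (Fin 2) (Fin 2) ℂ) (s : ℝ), (∀ b, ‖X b‖ ≤ s) →
        ∀ bd : PBond (i.1.1.P i.1.2.2) 0,
          ‖(toL2 i.1.1 i.1.2.2 (c₀ L)).symm (GT i.1.1 i.1.2.1 i.1.2.2 i.2.2.le (c₀ L) (cB L) a (DeltaEtaSlot i.1.1 i.1.2.1 i.1.2.2 (c₀ L)) U₀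
              (toL2 i.1.1 i.1.2.2 (c₀ L) X)) bd‖
            ≤ BV L * s := by
  obtain ⟨αG, BV, δG, hα, hW1, hW2, hW3, hBV, hδG, hmem⟩ := blockSup_GT_DeltaEtaSlot_family c₀ cB ha₀ ha₀₁
  refine ⟨αG, fun L => BV L * (2 * (1 + 1 / δG L)) ^ 3, hα, hW1, hW2, hW3, fun L hL => ?_, ?_⟩
  · have := hBV L hL
    have := hδG L hL
    positivity
  intro L hL i U₀ ρ hreg hρ hlift a ha₀a ha₁a X s hX bd
  haveI : Nonempty (PBond (i.1.1.P i.1.2.2) 0) := ⟨bd⟩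
  exact sup_of_blockSupported (fun b : PBond (i.1.1.P i.1.2.2) 0 => iterBlockOf (i.1.2.2 - i.1.2.1) b.src) (fun b : PBond (i.1.1.P i.1.2.2) 0 => iterBlockOf (i.1.2.2 - i.1.2.1) b.src)
    (fun (Y : PBond (i.1.1.P i.1.2.2) 0 → Matrix (Fin 2) (Fin 2) ℂ) (bd' : PBond (i.1.1.P i.1.2.2) 0) =>
      (toL2 i.1.1 i.1.2.2 (c₀ L)).symm (GT i.1.1 i.1.2.1 i.1.2.2 i.2.2.le (c₀ L) (cB L) a (DeltaEtaSlot i.1.1 i.1.2.1 i.1.2.2 (c₀ L)) U₀ (toL2 i.1.1 i.1.2.2 (c₀ L) Y)) bd')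
    (valueReader_blockAdditive i.1.1 i.2.2.le (c₀ L) (cB L) a U₀) (hδG L hL)
    (hmem L hL i U₀ ρ hreg hρ hlift a ha₀a ha₁a) X s hX bd

/-- ★★★ **(D0) FOR ALL MEMBERS WITH ROOM, L-ONLY CONSTANTS** — FILE C ∕ (O-G1)'s `hDiv` letter (the sup covariant-divergence row of `G₀` on sup-bounded sources) for every `L > 1`, every
member `i : Idx L`, every printed-regular background below the cap, under `Lift`, in the coupling window, GIVEN THE MEMBER'S NO-WRAP ROOM `2(12ℓ + 5) ≤ sitesPerDir 0` (displayed —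
the T1-lineage letter, CHAIR WORD №1 class): `∃ αG BD : ℕ → ℝ` with the three windows of record and `0 ≤ BD L`; binder texts = ✓`divergence_GT_DeltaEtaSlot_family`'s, conclusion the
SUP text (`BD L := CD L·(2(1+1∕δG L))³`).  PROOF: that family's package and §1 per member.
[cite: Balaban1985BackgroundPropagators, Thm 3.1 (3.42)–(3.44) p.397, Thm 3.3 (3.47)–(3.49) pp.398–399, Thm 3.12 p.422; Balaban1985Variational, Thm 1 p.279, (134)–(135) p.298] -/
theorem divergence_GT_DeltaEtaSlot_sup_family (c₀ cB : ℕ → ℝ) [hc₀ : ∀ L : ℕ, Fact (0 < c₀ L)] [hcB : ∀ L : ℕ, Fact (0 < cB L)] {a₀ a₁ : ℝ} (ha₀ : 0 < a₀) (ha₀₁ : a₀ ≤ a₁) :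
    ∃ (αG BD : ℕ → ℝ),
      (∀ L : ℕ, 1 < L → 0 < αG L) ∧ (∀ L : ℕ, 1 < L → 10 ^ 12 * (L : ℝ) ^ 3 * αG L ≤ 1) ∧ (∀ L : ℕ, 1 < L → 10 ^ 10 * (L : ℝ) ^ 6 * αG L ≤ 1) ∧
      (∀ L : ℕ, 1 < L → 13 * 10 ^ 14 * (L : ℝ) ^ 3 * αG L ≤ 1) ∧ (∀ L : ℕ, 1 < L → 0 ≤ BD L) ∧
    ∀ (L : ℕ), 1 < L → ∀ (i : T3Thm1Carrier.Idx L) (U₀ : GaugeField (i.1.1.P i.1.2.2) 0 (Matrix.specialUnitaryGroup (Fin 2) ℂ)), ∀ ρ : ℝ, RegPr i.1.1 i.1.2.1 i.1.2.2 ρ U₀ → ρ ≤ αG L →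
        (∀ cf : Site (i.1.1.P i.1.2.2) (i.1.2.2 - i.1.2.1) → Matrix (Fin 2) (Fin 2) ℂ,
        (∀ e' : PBond (i.1.1.P i.1.2.2) (i.1.2.2 - i.1.2.1), cf e'.src = ((emlIterU (i.1.2.2 - i.1.2.1) (bgUnits i.1.1 i.1.2.2 U₀) e' : (Matrix (Fin 2) (Fin 2) ℂ)ˣ) : Matrix (Fin 2) (Fin 2) ℂ) * cf e'.tgt *
        (((emlIterU (i.1.2.2 - i.1.2.1) (bgUnits i.1.1 i.1.2.2 U₀) e')⁻¹ : (Matrix (Fin 2) (Fin 2) ℂ)ˣ) : Matrix (Fin 2) (Fin 2) ℂ)) →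
        ∃ l₀ : Site (i.1.1.P i.1.2.2) 0 → Matrix (Fin 2) (Fin 2) ℂ,
        (∀ b' : PBond (i.1.1.P i.1.2.2) 0, l₀ b'.src = ((bgUnits i.1.1 i.1.2.2 U₀ b' : (Matrix (Fin 2) (Fin 2) ℂ)ˣ) : Matrix (Fin 2) (Fin 2) ℂ) * l₀ b'.tgt * (((bgUnits i.1.1 i.1.2.2 U₀ b')⁻¹ : (Matrix (Fin 2) (Fin 2) ℂ)ˣ) : Matrix (Fin 2) (Fin 2) ℂ)) ∧
        ∀ y : Site (i.1.1.P i.1.2.2) (i.1.2.2 - i.1.2.1), l₀ (embIter (i.1.2.2 - i.1.2.1) y) = cf y) →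
      ∀ a : ℝ, a₀ * (c₀ L / cB L) * ((i.1.1.L : ℝ) ^ (i.1.2.2 - i.1.2.1)) ^ 3 ≤ a → a ≤ a₁ * (c₀ L / cB L) * ((i.1.1.L : ℝ) ^ (i.1.2.2 - i.1.2.1)) ^ 3 →
      2 * (12 * i.1.1.L ^ (i.1.2.2 - i.1.2.1) + 5) ≤ (i.1.1.P i.1.2.2).sitesPerDir 0 →
      ∀ (X : PBond (i.1.1.P i.1.2.2) 0 → Matrix (Fin 2) (Fin 2) ℂ) (s : ℝ), (∀ b, ‖X b‖ ≤ s) →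
        ∀ x : Site (i.1.1.P i.1.2.2) 0,
          ‖(toL2S i.1.1 i.1.2.2 (c₀ L)).symm (DstarL2 i.1.1 i.1.2.1 i.1.2.2 (c₀ L) U₀ (GT i.1.1 i.1.2.1 i.1.2.2 i.2.2.le (c₀ L) (cB L) a
              (DeltaEtaSlot i.1.1 i.1.2.1 i.1.2.2 (c₀ L)) U₀ (toL2 i.1.1 i.1.2.2 (c₀ L) X))) x‖
            ≤ BD L * s := by
  obtain ⟨αG, CD, δG, hα, hW1, hW2, hW3, hCD, hδG, hmem⟩ := divergence_GT_DeltaEtaSlot_family c₀ cB ha₀ ha₀₁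
  refine ⟨αG, fun L => CD L * (2 * (1 + 1 / δG L)) ^ 3, hα, hW1, hW2, hW3, fun L hL => ?_, ?_⟩
  · have := hCD L hL
    have := hδG L hL
    positivity
  intro L hL i U₀ ρ hreg hρ hlift a ha₀a ha₁a hroom X s hX x
  haveI : Nonempty (PBond (i.1.1.P i.1.2.2) 0) := ⟨⟨x, ⟨0, by rw [T3Family.P_d]; norm_num⟩⟩⟩
  exact sup_of_blockSupported (fun b : PBond (i.1.1.P i.1.2.2) 0 => iterBlockOf (i.1.2.2 - i.1.2.1) b.src) (fun x' : Site (i.1.1.P i.1.2.2) 0 => iterBlockOf (i.1.2.2 - i.1.2.1) x')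
    (fun (Y : PBond (i.1.1.P i.1.2.2) 0 → Matrix (Fin 2) (Fin 2) ℂ) (x' : Site (i.1.1.P i.1.2.2) 0) =>
      (toL2S i.1.1 i.1.2.2 (c₀ L)).symm (DstarL2 i.1.1 i.1.2.1 i.1.2.2 (c₀ L) U₀ (GT i.1.1 i.1.2.1 i.1.2.2 i.2.2.le (c₀ L) (cB L) a
        (DeltaEtaSlot i.1.1 i.1.2.1 i.1.2.2 (c₀ L)) U₀ (toL2 i.1.1 i.1.2.2 (c₀ L) Y))) x')
    (divReader_blockAdditive i.1.1 i.2.2.le (c₀ L) (cB L) a U₀) (hδG L hL)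
    (hmem L hL i U₀ ρ hreg hρ hlift a ha₀a ha₁a hroom) X s hX x


/-! ## §2 The joint package at one cap -/

/-- ★★★ **(V0)+(D0) FOR ALL MEMBERS WITH ROOM AT ONE CAP, L-ONLY CONSTANTS** — `∃ αG BV BD : ℕ → ℝ` (cap with the three windows of record, `0 ≤ BV L`, `0 ≤ BD L`) such that for
every `L > 1`, member `i : Idx L`, background `U₀` with `RegPr ρ U₀`, `ρ ≤ αG L`, under `Lift`, every coupling in the window, given the member's no-wrap ROOM: BOTH FILE C ∕ (O-G1)
letters, the `hV` TEXT `… ≤ BV L * s` AND the `hDiv` TEXT `… ≤ BD L * s` (cap `αG := min` of §1's two caps).  [cite: Balaban1985BackgroundPropagators, Thm 3.1 (3.42) p.397,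
Thm 3.3 (3.47)–(3.49) pp.398–399, Thm 3.12 p.422–423; Balaban1985Variational, Thm 1 p.279] -/
theorem valueDiv_GT_DeltaEtaSlot_sup_family (c₀ cB : ℕ → ℝ) [hc₀ : ∀ L : ℕ, Fact (0 < c₀ L)] [hcB : ∀ L : ℕ, Fact (0 < cB L)] {a₀ a₁ : ℝ} (ha₀ : 0 < a₀) (ha₀₁ : a₀ ≤ a₁) :
    ∃ (αG BV BD : ℕ → ℝ),
      (∀ L : ℕ, 1 < L → 0 < αG L) ∧ (∀ L : ℕ, 1 < L → 10 ^ 12 * (L : ℝ) ^ 3 * αG L ≤ 1) ∧ (∀ L : ℕ, 1 < L → 10 ^ 10 * (L : ℝ) ^ 6 * αG L ≤ 1) ∧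
      (∀ L : ℕ, 1 < L → 13 * 10 ^ 14 * (L : ℝ) ^ 3 * αG L ≤ 1) ∧ (∀ L : ℕ, 1 < L → 0 ≤ BV L) ∧ (∀ L : ℕ, 1 < L → 0 ≤ BD L) ∧
    ∀ (L : ℕ), 1 < L → ∀ (i : T3Thm1Carrier.Idx L) (U₀ : GaugeField (i.1.1.P i.1.2.2) 0 (Matrix.specialUnitaryGroup (Fin 2) ℂ)), ∀ ρ : ℝ, RegPr i.1.1 i.1.2.1 i.1.2.2 ρ U₀ → ρ ≤ αG L →
        (∀ cf : Site (i.1.1.P i.1.2.2) (i.1.2.2 - i.1.2.1) → Matrix (Fin 2) (Fin 2) ℂ,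
        (∀ e' : PBond (i.1.1.P i.1.2.2) (i.1.2.2 - i.1.2.1), cf e'.src = ((emlIterU (i.1.2.2 - i.1.2.1) (bgUnits i.1.1 i.1.2.2 U₀) e' : (Matrix (Fin 2) (Fin 2) ℂ)ˣ) : Matrix (Fin 2) (Fin 2) ℂ) * cf e'.tgt *
        (((emlIterU (i.1.2.2 - i.1.2.1) (bgUnits i.1.1 i.1.2.2 U₀) e')⁻¹ : (Matrix (Fin 2) (Fin 2) ℂ)ˣ) : Matrix (Fin 2) (Fin 2) ℂ)) →
        ∃ l₀ : Site (i.1.1.P i.1.2.2) 0 → Matrix (Fin 2) (Fin 2) ℂ,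
        (∀ b' : PBond (i.1.1.P i.1.2.2) 0, l₀ b'.src = ((bgUnits i.1.1 i.1.2.2 U₀ b' : (Matrix (Fin 2) (Fin 2) ℂ)ˣ) : Matrix (Fin 2) (Fin 2) ℂ) * l₀ b'.tgt * (((bgUnits i.1.1 i.1.2.2 U₀ b')⁻¹ : (Matrix (Fin 2) (Fin 2) ℂ)ˣ) : Matrix (Fin 2) (Fin 2) ℂ)) ∧
        ∀ y : Site (i.1.1.P i.1.2.2) (i.1.2.2 - i.1.2.1), l₀ (embIter (i.1.2.2 - i.1.2.1) y) = cf y) →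
      ∀ a : ℝ, a₀ * (c₀ L / cB L) * ((i.1.1.L : ℝ) ^ (i.1.2.2 - i.1.2.1)) ^ 3 ≤ a → a ≤ a₁ * (c₀ L / cB L) * ((i.1.1.L : ℝ) ^ (i.1.2.2 - i.1.2.1)) ^ 3 →
      2 * (12 * i.1.1.L ^ (i.1.2.2 - i.1.2.1) + 5) ≤ (i.1.1.P i.1.2.2).sitesPerDir 0 →
      (∀ (X : PBond (i.1.1.P i.1.2.2) 0 → Matrix (Fin 2) (Fin 2) ℂ) (s : ℝ), (∀ b, ‖X b‖ ≤ s) →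
        ∀ bd : PBond (i.1.1.P i.1.2.2) 0,
          ‖(toL2 i.1.1 i.1.2.2 (c₀ L)).symm (GT i.1.1 i.1.2.1 i.1.2.2 i.2.2.le (c₀ L) (cB L) a (DeltaEtaSlot i.1.1 i.1.2.1 i.1.2.2 (c₀ L)) U₀
              (toL2 i.1.1 i.1.2.2 (c₀ L) X)) bd‖
            ≤ BV L * s) ∧
      (∀ (X : PBond (i.1.1.P i.1.2.2) 0 → Matrix (Fin 2) (Fin 2) ℂ) (s : ℝ), (∀ b, ‖X b‖ ≤ s) →
        ∀ x : Site (i.1.1.P i.1.2.2) 0,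
          ‖(toL2S i.1.1 i.1.2.2 (c₀ L)).symm (DstarL2 i.1.1 i.1.2.1 i.1.2.2 (c₀ L) U₀ (GT i.1.1 i.1.2.1 i.1.2.2 i.2.2.le (c₀ L) (cB L) a
              (DeltaEtaSlot i.1.1 i.1.2.1 i.1.2.2 (c₀ L)) U₀ (toL2 i.1.1 i.1.2.2 (c₀ L) X))) x‖
            ≤ BD L * s) := by
  obtain ⟨αV, BV, hαV, hV1, hV2, hV3, hBV, hmemV⟩ := value_GT_DeltaEtaSlot_sup_family c₀ cB ha₀ ha₀₁
  obtain ⟨αD, BD, hαD, -, -, -, hBD, hmemD⟩ := divergence_GT_DeltaEtaSlot_sup_family c₀ cB ha₀ ha₀₁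
  refine ⟨fun L => min (αV L) (αD L), BV, BD, fun L hL => lt_min (hαV L hL) (hαD L hL), fun L hL => ?_, fun L hL => ?_, fun L hL => ?_, hBV, hBD, ?_⟩
  · exact (mul_le_mul_of_nonneg_left (min_le_left _ _) (by positivity)).trans (hV1 L hL)
  · exact (mul_le_mul_of_nonneg_left (min_le_left _ _) (by positivity)).trans (hV2 L hL)
  · exact (mul_le_mul_of_nonneg_left (min_le_left _ _) (by positivity)).trans (hV3 L hL)
  intro L hL i U₀ ρ hreg hρ hlift a ha₀a ha₁a hroom
  exact ⟨hmemV L hL i U₀ ρ hreg (hρ.trans (min_le_left _ _)) hlift a ha₀a ha₁a,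
    hmemD L hL i U₀ ρ hreg (hρ.trans (min_le_right _ _)) hlift a ha₀a ha₁a hroom⟩

end Summit.QuantumFields.YangMills.Theorems.Prop7OneFormGreenSupRowsFamily

end
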